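import Literature.MathematicalPhysics.QuantumFieldTheory.Balaban1983to89.B11Eq34BCH
import Literature.MathematicalPhysics.QuantumFieldTheory.Balaban1983to89.B11Smallness

/-!
# `Balaban1983to89.B11Eq37NormBound` — T. Bałaban, *The variational problem and background fields in renormalization group method for lattice gauge theories*, Commun. Math. Phys. **102** (1985) 277–309 [Balaban1985Variational]: (37) p. 284, FIRST MEMBER — «From this representation [(36)] we obtain easily the bound |V^{(3)}(A, ∂p)| ≦ ½|(DA)(p)|(|A|(∂p))² + ½η(|A|(∂p))³C₁B₃ε₁(Lʲη)⁻²» PROVED from the verbatim (36) (`B11Eq34BCH.V3`) over a normed `ℂ`-algebra with a trace functional, by commutator norm bounds and the cubic counting inequality; then the whole printed chain (37) by `B11Smallness.ineq37`; v2 (same seat): the separation (39) `V₀ = ½tr(DA)(p)Σi[A′,A′] + V₀′` and the FIRST MEMBER of (40) «|V₀′(A, ∂p)| ≦ (|A|(∂p))³ηC₁B₃ε₁(Lʲη)⁻² + (2/4!)(|A|(∂p))⁴» PROVED the same way («the expression with Re U₀(∂p) − 1 has a hidden additional factor η²»), then the whole chain (40) by `B11Smallness.ineq40` (theorem-only module)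

statement-level skeleton of published theorems with citation tags; proofs where landed; nothing here is a claim about the Yang–Mills mass gap

PDF held: `paper:balaban1985-cmp102-variational-background` (journal page = PDF page + 276).  Renders
`run/shared/lean/pub/pub-balaban/b2b-balaban-ref1/pages/1985-cmp102-variational-background/…-p007-x2.png` (p. 283) and
`…-p008-x2.png` (p. 284) READ AS IMAGES by this seat (lit-balaban reader/typer r08, gen 3, 2026-08-21).

v2.1 (r08 gen 41, 2026-08-22): DOCFIX ONLY — the p. 282 sentence quoted in this header restored to the verbatim «The
expression in parenthesis (…) on the right-hand side is equal to η(DA)(p)» (v1/v2 clipped «on the right-hand side»; r08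
`QUOTE-AUDIT-B11.md` §C item L1; render `…-p006-x2.png` re-read). Declarations byte-identical.

CITATION HEADER (lean-in-tree rule 2026-08-18).  WHAT IS REPRODUCED: SKELETON rows `B11.Eq37` = display (37) p. 284 and
(v2) `B11.Eq39` = displays (39)–(40) p. 284 (first members; the further members are `B11Smallness.ineq37`/`ineq40`).
(37)'s FIRST member (the passage from the matrix expression (36) to norms) was the part not typed so far; the three further
members are the real arithmetic `B11Smallness.ineq37` (gen 1).  Sibling modules: `B11Eq34BCH` ((34) through degree 3,
(36) `V3` VERBATIM as a definition over an abstract trace — imported), `B11Smallness` (imported for the chain),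
`B11Eq22Remainder` ((22)–(23), (38)).

THE PRINT (pp. 283–284 [PDF 7–8], verbatim from the renders).  «then (34) yields
  V^{(3)}(A, ∂p) = ¼ tr[(DA)(p) Σ_{b₁≺b₂} i[A′(b₁), A′(b₂)] + Σ_{b₁≺b₂} i[A′(b₁), A′(b₂)](DA)(p)] Re U₀(∂p)
    + (1/12)η tr Σ_{b₁≺b₂} (i[A′(b₁), i[A′(b₁), A′(b₂)]] + i[i[A′(b₁), A′(b₂)], A′(b₂)])η⁻² Im U₀(∂p)
    + (1/6)η tr Σ_{b₁≺b₂≺b₃} (i[A′(b₁), i[A′(b₂), A′(b₃)]] + i[i[A′(b₁), A′(b₂)], A′(b₃)])η⁻² Im U₀(∂p)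
    − (1/3!)η⁴ tr((DA)(p))³η⁻² Im U₀(∂p). (36)
From this representation we obtain easily the bound
  |V^{(3)}(A, ∂p)| ≦ ½|(DA)(p)|(|A|(∂p))² + ½η(|A|(∂p))³C₁B₃ε₁(Lʲη)⁻²
    ≦ 8|A|²|(DA)(p)| + 32η|A|³C₁B₃ε₁(Lʲη)⁻²
    < 8ε₂²(Lʲη)⁻²|(DA)(p)| + 32L⁻ʲC₁B₃ε₁ε₂³(Lʲη)⁻⁴
    < 16ε₂³(1 + 2C₁B₃ε₁)(Lʲη)⁻⁴, p ∈ Ω_j. (37)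
The first trace on the right-hand side of (36) depends on the derivative (DA)(p), the remaining expressions depend on
the field variables A only, and to estimate them we need to know bounds on A, not on derivatives of A. Let us separate
the term with the derivative. We have Re U₀(∂p) = 1 + (Re U₀(∂p) − 1), and
  |η⁻²(Re U₀(∂p) − 1)| < C₁B₃ε₁(Lʲη)⁻², p ∈ Ω_j, (38)
so the expression with Re U₀(∂p) − 1 has a hidden additional factor η². One factor η cancels η⁻¹ in the derivative
(DA)(p), and the expression can be estimated by ½η(|A|(∂p))³C₁B₃ε₁(Lʲη)⁻². Thus we can write
  V₀(A, ∂p) = ½ tr(DA)(p) Σ_{b₁≺b₂} i[A′(b₁), A′(b₂)] + V₀′(A, ∂p), (39)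
where V₀′(A, ∂p) is defined by this equality, and satisfies the bound
  |V₀′(A, ∂p)| ≦ (|A|(∂p))³ηC₁B₃ε₁(Lʲη)⁻² + (2/4!)(|A|(∂p))⁴ ≦ 64|A|³(L⁻ʲC₁B₃ε₁(Lʲη)⁻¹ + ⅓|A|)
    ≦ 64|A|³(C₁B₃ε₁ + ε₂)(Lʲη)⁻¹ < 64ε₂³(C₁B₃ε₁ + ε₂)(Lʲη)⁻⁴, p ∈ Ω_j. (40)
Here we have used only the first bound (32) on the field A alone.»  With (29) p. 282 «V₀(A) = V^{(3)}(A) + V₄(A)» and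
(33) p. 283 «|V₄(A, ∂p)| ≦ (2/4!)(|A|(∂p))⁴».  Inputs named
around it: (25)/(34) «Σ_b A′(b) = η(DA)(p)» (p. 282: «The expression in parenthesis (…) on the right-hand side is equal to η(DA)(p)»), the
background bound (14)/(38) «|η⁻²(Re U₀(∂p) − 1)| < C₁B₃ε₁(Lʲη)⁻²» and its companion for `η⁻² Im U₀(∂p)`, unitarity of
`U₀(∂p)` (`|Re U₀(∂p)| ≦ 1`), and (32) «Lʲη|A|, (Lʲη)²|∇A| < ε₂ on Ω_j».

DICTIONARY (abstract; nothing re-declared).  `𝔸` = a normed `ℂ`-algebra (the matrices, with a submultiplicative norm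
`|·|`); `τ : 𝔸 →ₗ[ℂ] ℂ` = print's `tr`; `D = (DA)(p)`, `Y₁ ≺ Y₂ ≺ Y₃ ≺ Y₄ = A′(b)`, `b ⊂ (∂p)_z`, `ReU = Re U₀(∂p)`,
`ImU2 = η⁻² Im U₀(∂p)` exactly as in `B11Eq34BCH.V3`; real data: `aᵢ ≥ |A′(bᵢ)|` (`= |A(bᵢ)|`, the rotations `R(U₀)`
being isometries), `S ≥ a₁ + a₂ + a₃ + a₄` (print's `|A|(∂p)`), `δ ≥ |(DA)(p)|`, `η|(DA)(p)| ≦ S` (from `η(DA)(p) =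
Σ_b A′(b)`), `κ = C₁B₃ε₁(Lʲη)⁻²`.  The two trace estimates the print uses silently are the hypotheses
`hRe : |tr(Z·Re U₀(∂p))| ≦ |Z|` (unitarity) and `hIm : |tr(Z·η⁻²Im U₀(∂p))| ≦ |Z|·κ` ((14)/(38)).

WHAT IS CERTIFIED (kernel, sorry-free; axioms `propext` / `Classical.choice` / `Quot.sound`).
§1 `norm_lie_le` (`|[X, Y]| ≦ 2|X||Y|`), `norm_comm2_le` (`|Σ_{i≺j}[Yᵢ, Yⱼ]| ≦ 2Σ_{i<j}aᵢaⱼ ≦ S²`), `norm_comm3pair_le`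
(`≦ 4Σ_{i<j}(aᵢ²aⱼ + aᵢaⱼ²)`), `norm_comm3triple_le` (`≦ 8Σ_{i<j<k}aᵢaⱼaₖ`), `counting37` (the cubic counting
`(1/3)Σ_{i<j}(aᵢ²aⱼ + aᵢaⱼ²) + (4/3)Σ_{i<j<k}aᵢaⱼaₖ ≦ (1/3)(Σaᵢ)³`).
§2 **(37) first member** `norm_V3_le`: `|V^{(3)}| ≦ ½δS² + ½ηS³κ` (from the weighted core estimate
`norm_V3_le_weighted`: `|tr(Z·W)| ≦ |Z|ρ` in the `Re U₀` slot gives `½δS²ρ + ½ηS³κ`); **(37) as printed, end to end**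
`ineq37_printed`: `|V^{(3)}(A, ∂p)| < 16ε₂³(1 + 2C₁B₃ε₁)(Lʲη)⁻⁴` under (32) (`|A| < ε₂(Lʲη)⁻¹`, `|(DA)(p)| <
2ε₂(Lʲη)⁻²`, `|A|(∂p) ≦ 4|A|`, `η ≦ Lʲη`), by `norm_V3_le` + `B11Smallness.ineq37`.
§3 **(39)** `V3_split39` (for a trace, `V^{(3)}[Re U₀] = ½tr((DA)(p)Σi[A′,A′]) + V^{(3)}[Re U₀ − 1]`); **(40) first
member** `ineq40_first`: for `V₀ = V^{(3)} + V₄` (29) with `|V₄| ≦ (2/4!)S⁴` (33) and `|tr(Z(Re U₀ − 1))| ≦ |Z|η²κ`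
(38), `|V₀ − ½tr((DA)(p)Σi[A′,A′])| ≦ S³ηκ + (2/4!)S⁴`; **(40) end to end** `ineq40_printed`
(`< 64ε₂³(C₁B₃ε₁ + ε₂)(Lʲη)⁻⁴`, via `B11Smallness.ineq40`).

HONEST SCOPE — what is NOT claimed.  (i) The identification of `V3` with the third-order term of `1 − Re tr ∂₀U₁((p)_z)
U₀(∂p)` ((35) ⇒ (36)) is NOT typed (row `B11.Eq34`: (34) certified through degree 3, (36) a definition).  (ii) The two
trace estimates `hRe`, `hIm` and the norm data are HYPOTHESES in print's letters (for matrices: Hölder for the trace with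
the norm conventions of [6], unitarity of `U₀`, and the background hypothesis (14)); the lattice objects are not
constructed.  (iii) Print's `≦`/`<` are kept (`norm_V3_le`/`ineq40_first` are `≤`, the end-to-end (37)/(40) are `<`); (38) itself is row `B11.Eq38` (`B11Eq22Remainder.ineq38`) and (33) is row `B11.Eq29` — both enter §3 as hypotheses (`hRe1`, `h33`); `V₀′` is not a separate `def` but the printed difference `V₀ − ½tr((DA)(p)Σi[A′,A′])`.  (iv) Nothing here is
progress on the summit `Summit.QuantumFields`.  Unit `lit-balaban-r08` gen 3 (row `B11.Eq37` of
`HOME/lit-balaban-r08/ROWS-B11.md`, HOME = `run/shared/lean/pub/lit-balaban/`).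
-/

namespace Literature.MathematicalPhysics.QuantumFieldTheory.Balaban1983to89.B11Eq37NormBound

open B11Eq34BCH (comm2 comm3pair comm3triple V3 V3_eq)

/-! ## §1 Commutator norm bounds and the counting inequality -/
section Commutators

variable {𝔸 : Type*} [NormedRing 𝔸]

/-- `|[X, Y]| ≦ |XY| + |YX| ≦ 2|X||Y|` (submultiplicative norm). [cite: Balaban1985Variational, (36)-(37) p.284] -/
theorem norm_lie_le (X Y : 𝔸) : ‖⁅X, Y⁆‖ ≤ 2 * ‖X‖ * ‖Y‖ := by
  rw [Ring.lie_def]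
  calc ‖X * Y - Y * X‖ ≤ ‖X * Y‖ + ‖Y * X‖ := norm_sub_le _ _
    _ ≤ ‖X‖ * ‖Y‖ + ‖Y‖ * ‖X‖ := add_le_add (norm_mul_le _ _) (norm_mul_le _ _)
    _ = 2 * ‖X‖ * ‖Y‖ := by ring

/-- `|[X, Y]| ≦ 2ab` for `|X| ≦ a`, `|Y| ≦ b`. [cite: Balaban1985Variational, (36)-(37) p.284] -/
theorem norm_lie_le_of_le {X Y : 𝔸} {a b : ℝ} (hX : ‖X‖ ≤ a) (hY : ‖Y‖ ≤ b) : ‖⁅X, Y⁆‖ ≤ 2 * a * b := by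
  have ha : 0 ≤ a := (norm_nonneg X).trans hX
  calc ‖⁅X, Y⁆‖ ≤ 2 * ‖X‖ * ‖Y‖ := norm_lie_le X Y
    _ ≤ 2 * a * b := by gcongr

/-- Double commutators: `|[X, [Y, Z]]| ≦ 4abc`. [cite: Balaban1985Variational, (36)-(37) p.284] -/
theorem norm_lie_lie_le {X Y Z : 𝔸} {a b c : ℝ} (hX : ‖X‖ ≤ a) (hY : ‖Y‖ ≤ b) (hZ : ‖Z‖ ≤ c) :
    ‖⁅X, ⁅Y, Z⁆⁆‖ ≤ 4 * a * b * c := by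
  have h := norm_lie_le_of_le hX (norm_lie_le_of_le hY hZ)
  linarith

/-- Double commutators: `|[[X, Y], Z]| ≦ 4abc`. [cite: Balaban1985Variational, (36)-(37) p.284] -/
theorem norm_lie_lie_le' {X Y Z : 𝔸} {a b c : ℝ} (hX : ‖X‖ ≤ a) (hY : ‖Y‖ ≤ b) (hZ : ‖Z‖ ≤ c) :
    ‖⁅⁅X, Y⁆, Z⁆‖ ≤ 4 * a * b * c := by
  have h := norm_lie_le_of_le (norm_lie_le_of_le hX hY) hZ
  linarith

variable {Y₁ Y₂ Y₃ Y₄ : 𝔸} {a₁ a₂ a₃ a₄ : ℝ}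

/-- `|Σ_{b₁≺b₂}[A′(b₁), A′(b₂)]| ≦ 2Σ_{i<j}aᵢaⱼ`. [cite: Balaban1985Variational, (36)-(37) p.284] -/
theorem norm_comm2_le (h₁ : ‖Y₁‖ ≤ a₁) (h₂ : ‖Y₂‖ ≤ a₂) (h₃ : ‖Y₃‖ ≤ a₃) (h₄ : ‖Y₄‖ ≤ a₄) :
    ‖comm2 Y₁ Y₂ Y₃ Y₄‖ ≤ 2 * (a₁ * a₂ + a₁ * a₃ + a₁ * a₄ + a₂ * a₃ + a₂ * a₄ + a₃ * a₄) := by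
  unfold comm2
  have e12 := norm_lie_le_of_le h₁ h₂
  have e13 := norm_lie_le_of_le h₁ h₃
  have e14 := norm_lie_le_of_le h₁ h₄
  have e23 := norm_lie_le_of_le h₂ h₃
  have e24 := norm_lie_le_of_le h₂ h₄
  have e34 := norm_lie_le_of_le h₃ h₄
  have t1 := norm_add_le (⁅Y₁, Y₂⁆ + ⁅Y₁, Y₃⁆ + ⁅Y₁, Y₄⁆ + ⁅Y₂, Y₃⁆ + ⁅Y₂, Y₄⁆) ⁅Y₃, Y₄⁆
  have t2 := norm_add_le (⁅Y₁, Y₂⁆ + ⁅Y₁, Y₃⁆ + ⁅Y₁, Y₄⁆ + ⁅Y₂, Y₃⁆) ⁅Y₂, Y₄⁆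
  have t3 := norm_add_le (⁅Y₁, Y₂⁆ + ⁅Y₁, Y₃⁆ + ⁅Y₁, Y₄⁆) ⁅Y₂, Y₃⁆
  have t4 := norm_add_le (⁅Y₁, Y₂⁆ + ⁅Y₁, Y₃⁆) ⁅Y₁, Y₄⁆
  have t5 := norm_add_le ⁅Y₁, Y₂⁆ ⁅Y₁, Y₃⁆
  linarith

/-- `2Σ_{i<j}aᵢaⱼ ≦ (Σᵢaᵢ)²` for `aᵢ ≧ 0`, hence `|Σ_{b₁≺b₂}[A′(b₁), A′(b₂)]| ≦ (|A|(∂p))²`.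
[cite: Balaban1985Variational, (37) p.284] -/
theorem norm_comm2_le_sq (h₁ : ‖Y₁‖ ≤ a₁) (h₂ : ‖Y₂‖ ≤ a₂) (h₃ : ‖Y₃‖ ≤ a₃) (h₄ : ‖Y₄‖ ≤ a₄) {S : ℝ}
    (hS : a₁ + a₂ + a₃ + a₄ ≤ S) : ‖comm2 Y₁ Y₂ Y₃ Y₄‖ ≤ S ^ 2 := by
  have ha₁ : 0 ≤ a₁ := (norm_nonneg _).trans h₁
  have ha₂ : 0 ≤ a₂ := (norm_nonneg _).trans h₂
  have ha₃ : 0 ≤ a₃ := (norm_nonneg _).trans h₃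
  have ha₄ : 0 ≤ a₄ := (norm_nonneg _).trans h₄
  have h := norm_comm2_le h₁ h₂ h₃ h₄
  have hsq : (a₁ + a₂ + a₃ + a₄) ^ 2 ≤ S ^ 2 := pow_le_pow_left₀ (by positivity) hS 2
  nlinarith [sq_nonneg a₁, sq_nonneg a₂, sq_nonneg a₃, sq_nonneg a₄]

/-- `|Σ_{b₁≺b₂}([A′(b₁), [A′(b₁), A′(b₂)]] + [[A′(b₁), A′(b₂)], A′(b₂)])| ≦ 4Σ_{i<j}(aᵢ²aⱼ + aᵢaⱼ²)`.
[cite: Balaban1985Variational, (36)-(37) p.284] -/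
theorem norm_comm3pair_le (h₁ : ‖Y₁‖ ≤ a₁) (h₂ : ‖Y₂‖ ≤ a₂) (h₃ : ‖Y₃‖ ≤ a₃) (h₄ : ‖Y₄‖ ≤ a₄) :
    ‖comm3pair Y₁ Y₂ Y₃ Y₄‖ ≤
      4 * ((a₁ ^ 2 * a₂ + a₁ * a₂ ^ 2) + (a₁ ^ 2 * a₃ + a₁ * a₃ ^ 2) + (a₁ ^ 2 * a₄ + a₁ * a₄ ^ 2)
        + (a₂ ^ 2 * a₃ + a₂ * a₃ ^ 2) + (a₂ ^ 2 * a₄ + a₂ * a₄ ^ 2) + (a₃ ^ 2 * a₄ + a₃ * a₄ ^ 2)) := by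
  unfold comm3pair
  -- the twelve double commutators
  have p12 := norm_lie_lie_le h₁ h₁ h₂; have q12 := norm_lie_lie_le' h₁ h₂ h₂
  have p13 := norm_lie_lie_le h₁ h₁ h₃; have q13 := norm_lie_lie_le' h₁ h₃ h₃
  have p14 := norm_lie_lie_le h₁ h₁ h₄; have q14 := norm_lie_lie_le' h₁ h₄ h₄
  have p23 := norm_lie_lie_le h₂ h₂ h₃; have q23 := norm_lie_lie_le' h₂ h₃ h₃
  have p24 := norm_lie_lie_le h₂ h₂ h₄; have q24 := norm_lie_lie_le' h₂ h₄ h₄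
  have p34 := norm_lie_lie_le h₃ h₃ h₄; have q34 := norm_lie_lie_le' h₃ h₄ h₄
  -- the six pair sums
  have s12 := norm_add_le ⁅Y₁, ⁅Y₁, Y₂⁆⁆ ⁅⁅Y₁, Y₂⁆, Y₂⁆
  have s13 := norm_add_le ⁅Y₁, ⁅Y₁, Y₃⁆⁆ ⁅⁅Y₁, Y₃⁆, Y₃⁆
  have s14 := norm_add_le ⁅Y₁, ⁅Y₁, Y₄⁆⁆ ⁅⁅Y₁, Y₄⁆, Y₄⁆
  have s23 := norm_add_le ⁅Y₂, ⁅Y₂, Y₃⁆⁆ ⁅⁅Y₂, Y₃⁆, Y₃⁆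
  have s24 := norm_add_le ⁅Y₂, ⁅Y₂, Y₄⁆⁆ ⁅⁅Y₂, Y₄⁆, Y₄⁆
  have s34 := norm_add_le ⁅Y₃, ⁅Y₃, Y₄⁆⁆ ⁅⁅Y₃, Y₄⁆, Y₄⁆
  -- the outer sum
  have t1 := norm_add_le ((⁅Y₁, ⁅Y₁, Y₂⁆⁆ + ⁅⁅Y₁, Y₂⁆, Y₂⁆) + (⁅Y₁, ⁅Y₁, Y₃⁆⁆ + ⁅⁅Y₁, Y₃⁆, Y₃⁆)
    + (⁅Y₁, ⁅Y₁, Y₄⁆⁆ + ⁅⁅Y₁, Y₄⁆, Y₄⁆) + (⁅Y₂, ⁅Y₂, Y₃⁆⁆ + ⁅⁅Y₂, Y₃⁆, Y₃⁆)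
    + (⁅Y₂, ⁅Y₂, Y₄⁆⁆ + ⁅⁅Y₂, Y₄⁆, Y₄⁆)) (⁅Y₃, ⁅Y₃, Y₄⁆⁆ + ⁅⁅Y₃, Y₄⁆, Y₄⁆)
  have t2 := norm_add_le ((⁅Y₁, ⁅Y₁, Y₂⁆⁆ + ⁅⁅Y₁, Y₂⁆, Y₂⁆) + (⁅Y₁, ⁅Y₁, Y₃⁆⁆ + ⁅⁅Y₁, Y₃⁆, Y₃⁆)
    + (⁅Y₁, ⁅Y₁, Y₄⁆⁆ + ⁅⁅Y₁, Y₄⁆, Y₄⁆) + (⁅Y₂, ⁅Y₂, Y₃⁆⁆ + ⁅⁅Y₂, Y₃⁆, Y₃⁆))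
    (⁅Y₂, ⁅Y₂, Y₄⁆⁆ + ⁅⁅Y₂, Y₄⁆, Y₄⁆)
  have t3 := norm_add_le ((⁅Y₁, ⁅Y₁, Y₂⁆⁆ + ⁅⁅Y₁, Y₂⁆, Y₂⁆) + (⁅Y₁, ⁅Y₁, Y₃⁆⁆ + ⁅⁅Y₁, Y₃⁆, Y₃⁆)
    + (⁅Y₁, ⁅Y₁, Y₄⁆⁆ + ⁅⁅Y₁, Y₄⁆, Y₄⁆)) (⁅Y₂, ⁅Y₂, Y₃⁆⁆ + ⁅⁅Y₂, Y₃⁆, Y₃⁆)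
  have t4 := norm_add_le ((⁅Y₁, ⁅Y₁, Y₂⁆⁆ + ⁅⁅Y₁, Y₂⁆, Y₂⁆) + (⁅Y₁, ⁅Y₁, Y₃⁆⁆ + ⁅⁅Y₁, Y₃⁆, Y₃⁆))
    (⁅Y₁, ⁅Y₁, Y₄⁆⁆ + ⁅⁅Y₁, Y₄⁆, Y₄⁆)
  have t5 := norm_add_le (⁅Y₁, ⁅Y₁, Y₂⁆⁆ + ⁅⁅Y₁, Y₂⁆, Y₂⁆) (⁅Y₁, ⁅Y₁, Y₃⁆⁆ + ⁅⁅Y₁, Y₃⁆, Y₃⁆)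
  nlinarith

/-- `|Σ_{b₁≺b₂≺b₃}([A′(b₁), [A′(b₂), A′(b₃)]] + [[A′(b₁), A′(b₂)], A′(b₃)])| ≦ 8Σ_{i<j<k}aᵢaⱼaₖ`.
[cite: Balaban1985Variational, (36)-(37) p.284] -/
theorem norm_comm3triple_le (h₁ : ‖Y₁‖ ≤ a₁) (h₂ : ‖Y₂‖ ≤ a₂) (h₃ : ‖Y₃‖ ≤ a₃) (h₄ : ‖Y₄‖ ≤ a₄) :
    ‖comm3triple Y₁ Y₂ Y₃ Y₄‖ ≤
      8 * (a₁ * a₂ * a₃ + a₁ * a₂ * a₄ + a₁ * a₃ * a₄ + a₂ * a₃ * a₄) := by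
  unfold comm3triple
  have p123 := norm_lie_lie_le h₁ h₂ h₃; have q123 := norm_lie_lie_le' h₁ h₂ h₃
  have p124 := norm_lie_lie_le h₁ h₂ h₄; have q124 := norm_lie_lie_le' h₁ h₂ h₄
  have p134 := norm_lie_lie_le h₁ h₃ h₄; have q134 := norm_lie_lie_le' h₁ h₃ h₄
  have p234 := norm_lie_lie_le h₂ h₃ h₄; have q234 := norm_lie_lie_le' h₂ h₃ h₄
  have s123 := norm_add_le ⁅Y₁, ⁅Y₂, Y₃⁆⁆ ⁅⁅Y₁, Y₂⁆, Y₃⁆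
  have s124 := norm_add_le ⁅Y₁, ⁅Y₂, Y₄⁆⁆ ⁅⁅Y₁, Y₂⁆, Y₄⁆
  have s134 := norm_add_le ⁅Y₁, ⁅Y₃, Y₄⁆⁆ ⁅⁅Y₁, Y₃⁆, Y₄⁆
  have s234 := norm_add_le ⁅Y₂, ⁅Y₃, Y₄⁆⁆ ⁅⁅Y₂, Y₃⁆, Y₄⁆
  have t1 := norm_add_le ((⁅Y₁, ⁅Y₂, Y₃⁆⁆ + ⁅⁅Y₁, Y₂⁆, Y₃⁆) + (⁅Y₁, ⁅Y₂, Y₄⁆⁆ + ⁅⁅Y₁, Y₂⁆, Y₄⁆)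
    + (⁅Y₁, ⁅Y₃, Y₄⁆⁆ + ⁅⁅Y₁, Y₃⁆, Y₄⁆)) (⁅Y₂, ⁅Y₃, Y₄⁆⁆ + ⁅⁅Y₂, Y₃⁆, Y₄⁆)
  have t2 := norm_add_le ((⁅Y₁, ⁅Y₂, Y₃⁆⁆ + ⁅⁅Y₁, Y₂⁆, Y₃⁆) + (⁅Y₁, ⁅Y₂, Y₄⁆⁆ + ⁅⁅Y₁, Y₂⁆, Y₄⁆))
    (⁅Y₁, ⁅Y₃, Y₄⁆⁆ + ⁅⁅Y₁, Y₃⁆, Y₄⁆)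
  have t3 := norm_add_le (⁅Y₁, ⁅Y₂, Y₃⁆⁆ + ⁅⁅Y₁, Y₂⁆, Y₃⁆) (⁅Y₁, ⁅Y₂, Y₄⁆⁆ + ⁅⁅Y₁, Y₂⁆, Y₄⁆)
  linarith

end Commutators

/-- **The cubic counting inequality behind the second summand of (37)**: for `aᵢ ≧ 0`,
`(1/3)Σ_{i<j}(aᵢ²aⱼ + aᵢaⱼ²) + (4/3)Σ_{i<j<k}aᵢaⱼaₖ ≦ (1/3)(a₁ + a₂ + a₃ + a₄)³`
(since `(Σaᵢ)³ = Σaᵢ³ + 3Σ_{i≠j}aᵢ²aⱼ + 6Σ_{i<j<k}aᵢaⱼaₖ`). [cite: Balaban1985Variational, (37) p.284] -/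
theorem counting37 {a₁ a₂ a₃ a₄ : ℝ} (h₁ : 0 ≤ a₁) (h₂ : 0 ≤ a₂) (h₃ : 0 ≤ a₃) (h₄ : 0 ≤ a₄) :
    (1 / 3 : ℝ) * ((a₁ ^ 2 * a₂ + a₁ * a₂ ^ 2) + (a₁ ^ 2 * a₃ + a₁ * a₃ ^ 2) + (a₁ ^ 2 * a₄ + a₁ * a₄ ^ 2)
        + (a₂ ^ 2 * a₃ + a₂ * a₃ ^ 2) + (a₂ ^ 2 * a₄ + a₂ * a₄ ^ 2) + (a₃ ^ 2 * a₄ + a₃ * a₄ ^ 2))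
      + (4 / 3 : ℝ) * (a₁ * a₂ * a₃ + a₁ * a₂ * a₄ + a₁ * a₃ * a₄ + a₂ * a₃ * a₄)
      ≤ (1 / 3 : ℝ) * (a₁ + a₂ + a₃ + a₄) ^ 3 := by
  nlinarith [mul_nonneg (mul_nonneg h₁ h₁) h₁, mul_nonneg (mul_nonneg h₂ h₂) h₂, mul_nonneg (mul_nonneg h₃ h₃) h₃,
    mul_nonneg (mul_nonneg h₄ h₄) h₄, mul_nonneg (mul_nonneg h₁ h₁) h₂, mul_nonneg (mul_nonneg h₁ h₂) h₂,
    mul_nonneg (mul_nonneg h₁ h₁) h₃, mul_nonneg (mul_nonneg h₁ h₃) h₃, mul_nonneg (mul_nonneg h₁ h₁) h₄,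
    mul_nonneg (mul_nonneg h₁ h₄) h₄, mul_nonneg (mul_nonneg h₂ h₂) h₃, mul_nonneg (mul_nonneg h₂ h₃) h₃,
    mul_nonneg (mul_nonneg h₂ h₂) h₄, mul_nonneg (mul_nonneg h₂ h₄) h₄, mul_nonneg (mul_nonneg h₃ h₃) h₄,
    mul_nonneg (mul_nonneg h₃ h₄) h₄, mul_nonneg (mul_nonneg h₁ h₂) h₃, mul_nonneg (mul_nonneg h₁ h₂) h₄,
    mul_nonneg (mul_nonneg h₁ h₃) h₄, mul_nonneg (mul_nonneg h₂ h₃) h₄]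

/-! ## §2 (37): the first member from (36), and the printed chain -/
section Ineq37

variable {𝔸 : Type*} [NormedRing 𝔸] [NormedAlgebra ℂ 𝔸]
variable {τ : 𝔸 →ₗ[ℂ] ℂ} {D Y₁ Y₂ Y₃ Y₄ ReU ImU2 : 𝔸} {η a₁ a₂ a₃ a₄ S δ ρ κ : ℝ}

/-- **(37), first member, with a weight on the `Re U₀` trace** (the core estimate): for the verbatim (36)
`V3 τ D Y₁ Y₂ Y₃ Y₄ ReU ImU2 η` of `B11Eq34BCH`, with `|A′(bᵢ)| ≦ aᵢ`, `Σaᵢ ≦ S = |A|(∂p)`, `|(DA)(p)| ≦ δ`,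
`η|(DA)(p)| ≦ S` (as `η(DA)(p) = Σ_b A′(b)`), `η ≧ 0`, and the trace estimates `|tr(Z·W)| ≦ |Z|ρ` for the matrix `W` in
the `Re U₀(∂p)` slot (`ρ = 1` for `W = Re U₀(∂p)` by unitarity; `ρ = η²C₁B₃ε₁(Lʲη)⁻²` for `W = Re U₀(∂p) − 1` by (38) —
«so the expression with Re U₀(∂p) − 1 has a hidden additional factor η²»), `|tr(Z η⁻²Im U₀(∂p))| ≦ |Z|κ`:
`|V^{(3)}[W]| ≦ ½δS²ρ + ½ηS³κ`. [cite: Balaban1985Variational, (37)-(38) p.284] -/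
theorem norm_V3_le_weighted (h₁ : ‖Y₁‖ ≤ a₁) (h₂ : ‖Y₂‖ ≤ a₂) (h₃ : ‖Y₃‖ ≤ a₃) (h₄ : ‖Y₄‖ ≤ a₄)
    (hS : a₁ + a₂ + a₃ + a₄ ≤ S) (hD : ‖D‖ ≤ δ) (hηD : η * ‖D‖ ≤ S) (hη : 0 ≤ η) (hρ : 0 ≤ ρ) (hκ : 0 ≤ κ)
    (hRe : ∀ Z : 𝔸, ‖τ (Z * ReU)‖ ≤ ‖Z‖ * ρ) (hIm : ∀ Z : 𝔸, ‖τ (Z * ImU2)‖ ≤ ‖Z‖ * κ) :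
    ‖V3 τ D Y₁ Y₂ Y₃ Y₄ ReU ImU2 η‖ ≤ 1 / 2 * δ * S ^ 2 * ρ + 1 / 2 * η * S ^ 3 * κ := by
  have ha₁ : 0 ≤ a₁ := (norm_nonneg _).trans h₁
  have ha₂ : 0 ≤ a₂ := (norm_nonneg _).trans h₂
  have ha₃ : 0 ≤ a₃ := (norm_nonneg _).trans h₃
  have ha₄ : 0 ≤ a₄ := (norm_nonneg _).trans h₄
  have hsum0 : 0 ≤ a₁ + a₂ + a₃ + a₄ := by positivity
  have hS0 : 0 ≤ S := hsum0.trans hS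
  have hδ0 : 0 ≤ δ := (norm_nonneg _).trans hD
  have hηκ : 0 ≤ η * κ := mul_nonneg hη hκ
  -- the norm bounds of §1 and the counting inequality, then abbreviate the real data
  have hC : ‖comm2 Y₁ Y₂ Y₃ Y₄‖ ≤ S ^ 2 := norm_comm2_le_sq h₁ h₂ h₃ h₄ hS
  have hPn := norm_comm3pair_le h₁ h₂ h₃ h₄
  have hTn := norm_comm3triple_le h₁ h₂ h₃ h₄
  have hcount := counting37 ha₁ ha₂ ha₃ ha₄
  set P : ℝ := (a₁ ^ 2 * a₂ + a₁ * a₂ ^ 2) + (a₁ ^ 2 * a₃ + a₁ * a₃ ^ 2) + (a₁ ^ 2 * a₄ + a₁ * a₄ ^ 2)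
        + (a₂ ^ 2 * a₃ + a₂ * a₃ ^ 2) + (a₂ ^ 2 * a₄ + a₂ * a₄ ^ 2) + (a₃ ^ 2 * a₄ + a₃ * a₄ ^ 2) with hP
  set T : ℝ := a₁ * a₂ * a₃ + a₁ * a₂ * a₄ + a₁ * a₃ * a₄ + a₂ * a₃ * a₄ with hT
  have hP0 : 0 ≤ P := by rw [hP]; positivity
  have hT0 : 0 ≤ T := by rw [hT]; positivity
  have hcube : (a₁ + a₂ + a₃ + a₄) ^ 3 ≤ S ^ 3 := pow_le_pow_left₀ hsum0 hS 3
  have hPT : 1 / 3 * P + 4 / 3 * T ≤ 1 / 3 * S ^ 3 := hcount.trans (by linarith)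
  -- abbreviate the four complex terms of `V3_eq`
  set T1 : ℂ := (4 : ℂ)⁻¹ * Complex.I * τ ((D * comm2 Y₁ Y₂ Y₃ Y₄ + comm2 Y₁ Y₂ Y₃ Y₄ * D) * ReU) with hT1
  set T2 : ℂ := (12 : ℂ)⁻¹ * (η : ℂ) * τ (comm3pair Y₁ Y₂ Y₃ Y₄ * ImU2) with hT2
  set T3 : ℂ := (6 : ℂ)⁻¹ * (η : ℂ) * τ (comm3triple Y₁ Y₂ Y₃ Y₄ * ImU2) with hT3
  set T4 : ℂ := (6 : ℂ)⁻¹ * (η : ℂ) ^ 4 * τ (D * D * D * ImU2) with hT4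
  -- term 1: ¼|tr((DC + CD)ReU)| ≤ ¼·2|D||C| ≤ ½δS²
  have e1 : ‖T1‖ ≤ 1 / 2 * δ * S ^ 2 * ρ := by
    have h := hRe (D * comm2 Y₁ Y₂ Y₃ Y₄ + comm2 Y₁ Y₂ Y₃ Y₄ * D)
    have hDC : ‖D * comm2 Y₁ Y₂ Y₃ Y₄ + comm2 Y₁ Y₂ Y₃ Y₄ * D‖ ≤ 2 * (δ * S ^ 2) := by
      calc ‖D * comm2 Y₁ Y₂ Y₃ Y₄ + comm2 Y₁ Y₂ Y₃ Y₄ * D‖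
            ≤ ‖D * comm2 Y₁ Y₂ Y₃ Y₄‖ + ‖comm2 Y₁ Y₂ Y₃ Y₄ * D‖ := norm_add_le _ _
        _ ≤ ‖D‖ * ‖comm2 Y₁ Y₂ Y₃ Y₄‖ + ‖comm2 Y₁ Y₂ Y₃ Y₄‖ * ‖D‖ :=
            add_le_add (norm_mul_le _ _) (norm_mul_le _ _)
        _ ≤ δ * S ^ 2 + S ^ 2 * δ := by gcongr
        _ = 2 * (δ * S ^ 2) := by ring
    have h4 : ‖(4 : ℂ)⁻¹ * Complex.I‖ = 4⁻¹ := by simp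
    rw [hT1, norm_mul, h4]
    have := h.trans (mul_le_mul_of_nonneg_right hDC hρ)
    have h' : (4 : ℝ)⁻¹ * ‖τ ((D * comm2 Y₁ Y₂ Y₃ Y₄ + comm2 Y₁ Y₂ Y₃ Y₄ * D) * ReU)‖
        ≤ (4 : ℝ)⁻¹ * (2 * (δ * S ^ 2) * ρ) := mul_le_mul_of_nonneg_left this (by norm_num)
    linarith
  -- term 2: (1/12)η|tr(P·ImU2)| ≤ (1/12)η·4P·κ
  have e2 : ‖T2‖ ≤ 1 / 12 * η * (4 * P) * κ := by
    have h := (hIm (comm3pair Y₁ Y₂ Y₃ Y₄)).trans (mul_le_mul_of_nonneg_right hPn hκ)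
    have h12 : ‖(12 : ℂ)⁻¹ * (η : ℂ)‖ = 12⁻¹ * η := by simp [abs_of_nonneg hη]
    rw [hT2, norm_mul, h12]
    have h' : (12 : ℝ)⁻¹ * η * ‖τ (comm3pair Y₁ Y₂ Y₃ Y₄ * ImU2)‖ ≤ (12 : ℝ)⁻¹ * η * (4 * P * κ) :=
      mul_le_mul_of_nonneg_left h (by positivity)
    linarith
  -- term 3: (1/6)η|tr(T·ImU2)| ≤ (1/6)η·8T·κ
  have e3 : ‖T3‖ ≤ 1 / 6 * η * (8 * T) * κ := by
    have h := (hIm (comm3triple Y₁ Y₂ Y₃ Y₄)).trans (mul_le_mul_of_nonneg_right hTn hκ)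
    have h6 : ‖(6 : ℂ)⁻¹ * (η : ℂ)‖ = 6⁻¹ * η := by simp [abs_of_nonneg hη]
    rw [hT3, norm_mul, h6]
    have h' : (6 : ℝ)⁻¹ * η * ‖τ (comm3triple Y₁ Y₂ Y₃ Y₄ * ImU2)‖ ≤ (6 : ℝ)⁻¹ * η * (8 * T * κ) :=
      mul_le_mul_of_nonneg_left h (by positivity)
    linarith
  -- term 4: (1/6)η⁴|tr(D³·ImU2)| ≤ (1/6)η(η|D|)³κ ≤ (1/6)ηS³κ
  have e4 : ‖T4‖ ≤ 1 / 6 * η * S ^ 3 * κ := by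
    have hD3 : ‖D * D * D‖ ≤ ‖D‖ ^ 3 := by
      calc ‖D * D * D‖ ≤ ‖D * D‖ * ‖D‖ := norm_mul_le _ _
        _ ≤ ‖D‖ * ‖D‖ * ‖D‖ := by gcongr; exact norm_mul_le _ _
        _ = ‖D‖ ^ 3 := by ring
    have h := (hIm (D * D * D)).trans (mul_le_mul_of_nonneg_right hD3 hκ)
    have h6 : ‖(6 : ℂ)⁻¹ * (η : ℂ) ^ 4‖ = 6⁻¹ * η ^ 4 := by simp [abs_of_nonneg hη]
    rw [hT4, norm_mul, h6]
    have hηD0 : 0 ≤ η * ‖D‖ := mul_nonneg hη (norm_nonneg _)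
    have hcube' : (η * ‖D‖) ^ 3 ≤ S ^ 3 := pow_le_pow_left₀ hηD0 hηD 3
    have h' : (6 : ℝ)⁻¹ * η ^ 4 * ‖τ (D * D * D * ImU2)‖ ≤ (6 : ℝ)⁻¹ * η ^ 4 * (‖D‖ ^ 3 * κ) :=
      mul_le_mul_of_nonneg_left h (by positivity)
    have key : (6 : ℝ)⁻¹ * η ^ 4 * (‖D‖ ^ 3 * κ) = (6 : ℝ)⁻¹ * η * ((η * ‖D‖) ^ 3) * κ := by ring
    have h'' : (6 : ℝ)⁻¹ * η * ((η * ‖D‖) ^ 3) * κ ≤ (6 : ℝ)⁻¹ * η * S ^ 3 * κ := by gcongr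
    linarith
  -- assemble
  rw [V3_eq]
  change ‖T1 - T2 - T3 - T4‖ ≤ _
  have n : ‖T1 - T2 - T3 - T4‖ ≤ ‖T1‖ + ‖T2‖ + ‖T3‖ + ‖T4‖ := by
    have n1 := norm_sub_le (T1 - T2 - T3) T4
    have n2 := norm_sub_le (T1 - T2) T3
    have n3 := norm_sub_le T1 T2
    linarith
  have hmid : 1 / 12 * η * (4 * P) * κ + 1 / 6 * η * (8 * T) * κ + 1 / 6 * η * S ^ 3 * κ
      ≤ 1 / 2 * η * S ^ 3 * κ := by
    have h1 : η * κ * (1 / 3 * P + 4 / 3 * T) ≤ η * κ * (1 / 3 * S ^ 3) := mul_le_mul_of_nonneg_left hPT hηκ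
    have e : 1 / 12 * η * (4 * P) * κ + 1 / 6 * η * (8 * T) * κ = η * κ * (1 / 3 * P + 4 / 3 * T) := by ring
    have e' : 1 / 2 * η * S ^ 3 * κ = η * κ * (1 / 3 * S ^ 3) + 1 / 6 * η * S ^ 3 * κ := by ring
    rw [e, e']
    linarith
  linarith

/-- **(37), first member** «From this representation we obtain easily the bound |V^{(3)}(A, ∂p)| ≦ ½|(DA)(p)|(|A|(∂p))²
+ ½η(|A|(∂p))³C₁B₃ε₁(Lʲη)⁻²»: `norm_V3_le_weighted` with `ρ = 1` (`|tr(Z Re U₀(∂p))| ≦ |Z|`, unitarity of `U₀(∂p)`),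
`κ = C₁B₃ε₁(Lʲη)⁻²`: `|V^{(3)}| ≦ ½δS² + ½ηS³κ`. [cite: Balaban1985Variational, (37) p.284] -/
theorem norm_V3_le (h₁ : ‖Y₁‖ ≤ a₁) (h₂ : ‖Y₂‖ ≤ a₂) (h₃ : ‖Y₃‖ ≤ a₃) (h₄ : ‖Y₄‖ ≤ a₄)
    (hS : a₁ + a₂ + a₃ + a₄ ≤ S) (hD : ‖D‖ ≤ δ) (hηD : η * ‖D‖ ≤ S) (hη : 0 ≤ η) (hκ : 0 ≤ κ)
    (hRe : ∀ Z : 𝔸, ‖τ (Z * ReU)‖ ≤ ‖Z‖) (hIm : ∀ Z : 𝔸, ‖τ (Z * ImU2)‖ ≤ ‖Z‖ * κ) :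
    ‖V3 τ D Y₁ Y₂ Y₃ Y₄ ReU ImU2 η‖ ≤ 1 / 2 * δ * S ^ 2 + 1 / 2 * η * S ^ 3 * κ := by
  have h := norm_V3_le_weighted h₁ h₂ h₃ h₄ hS hD hηD hη zero_le_one hκ (fun Z => by simpa using hRe Z) hIm
  simpa using h

/-- **(37) as printed, end to end**: under (32) — `|A| = a < ε₂(Lʲη)⁻¹`, `|(DA)(p)| = δ < 2ε₂(Lʲη)⁻²`, `|A|(∂p) = S ≦
4|A|`, `η ≦ t = Lʲη` — and the hypotheses of `norm_V3_le` with `κ = K/t²`, `K = C₁B₃ε₁ ≧ 0`: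
`|V^{(3)}(A, ∂p)| < 16ε₂³(1 + 2C₁B₃ε₁)(Lʲη)⁻⁴` (first member here, the three further members `B11Smallness.ineq37`).
[cite: Balaban1985Variational, (37) p.284] -/
theorem ineq37_printed {a t K ε₂ : ℝ} (h₁ : ‖Y₁‖ ≤ a₁) (h₂ : ‖Y₂‖ ≤ a₂) (h₃ : ‖Y₃‖ ≤ a₃) (h₄ : ‖Y₄‖ ≤ a₄)
    (hS : a₁ + a₂ + a₃ + a₄ ≤ S) (hD : ‖D‖ ≤ δ) (hηD : η * ‖D‖ ≤ S)
    (hRe : ∀ Z : 𝔸, ‖τ (Z * ReU)‖ ≤ ‖Z‖) (hIm : ∀ Z : 𝔸, ‖τ (Z * ImU2)‖ ≤ ‖Z‖ * (K / t ^ 2))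
    (ht : 0 < t) (hη0 : 0 ≤ η) (hηt : η ≤ t) (ha0 : 0 ≤ a) (hSa : S ≤ 4 * a) (ha : a < ε₂ / t)
    (hδ : δ < 2 * ε₂ / t ^ 2) (hK : 0 ≤ K) :
    ‖V3 τ D Y₁ Y₂ Y₃ Y₄ ReU ImU2 η‖ < 16 * ε₂ ^ 3 * (1 + 2 * K) / t ^ 4 := by
  have hκ : 0 ≤ K / t ^ 2 := by positivity
  have hδ0 : 0 ≤ δ := (norm_nonneg _).trans hD
  have hS0 : 0 ≤ S :=
    (add_nonneg (add_nonneg (add_nonneg ((norm_nonneg _).trans h₁) ((norm_nonneg _).trans h₂))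
      ((norm_nonneg _).trans h₃)) ((norm_nonneg _).trans h₄)).trans hS
  have hfirst := norm_V3_le h₁ h₂ h₃ h₄ hS hD hηD hη0 hκ hRe hIm
  obtain ⟨c1, -, -, c4⟩ := B11Smallness.ineq37 a S δ η t K ε₂ ht hη0 hηt ha0 hS0 hSa ha hδ0 hδ hK
  have e : 1 / 2 * δ * S ^ 2 + 1 / 2 * η * S ^ 3 * (K / t ^ 2) =
      1 / 2 * δ * S ^ 2 + 1 / 2 * η * S ^ 3 * K / t ^ 2 := by ring
  rw [e] at hfirst
  exact lt_of_le_of_lt (hfirst.trans c1) c4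

end Ineq37

/-! ## §3 (38)–(40): separating the derivative term — `V₀ = ½tr(DA)(p)Σi[A′, A′] + V₀′` and the bound on `V₀′` -/
section Ineq40

variable {𝔸 : Type*} [NormedRing 𝔸] [NormedAlgebra ℂ 𝔸]
variable {τ : 𝔸 →ₗ[ℂ] ℂ} {D Y₁ Y₂ Y₃ Y₄ ReU ImU2 : 𝔸} {η a₁ a₂ a₃ a₄ S κ : ℝ}

/-- **(39), the separation** «We have Re U₀(∂p) = 1 + (Re U₀(∂p) − 1) … Thus we can write V₀(A, ∂p) = ½tr(DA)(p)
Σ_{b₁≺b₂} i[A′(b₁), A′(b₂)] + V₀′(A, ∂p)»: for a trace (`tr(Σi[A′,A′]·(DA)(p)) = tr((DA)(p)·Σi[A′,A′])`) the third-order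
term splits as `V^{(3)}[Re U₀] = ½tr((DA)(p)Σi[A′,A′]) + V^{(3)}[Re U₀ − 1]`.
[cite: Balaban1985Variational, (38)-(39) p.284] -/
theorem V3_split39 (hτ : τ (comm2 Y₁ Y₂ Y₃ Y₄ * D) = τ (D * comm2 Y₁ Y₂ Y₃ Y₄)) :
    V3 τ D Y₁ Y₂ Y₃ Y₄ ReU ImU2 η =
      (2 : ℂ)⁻¹ * Complex.I * τ (D * comm2 Y₁ Y₂ Y₃ Y₄) + V3 τ D Y₁ Y₂ Y₃ Y₄ (ReU - 1) ImU2 η := by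
  rw [V3_eq, V3_eq, mul_sub, mul_one, map_sub, map_add, hτ]
  ring

/-- **(40), first member** «|V₀′(A, ∂p)| ≦ (|A|(∂p))³ηC₁B₃ε₁(Lʲη)⁻² + (2/4!)(|A|(∂p))⁴», for `V₀′` «defined by this
equality» (39), i.e. `V₀′ = V₀ − ½tr(DA)(p)Σi[A′,A′]` with `V₀ = V^{(3)} + V₄` (29): from `V3_split39`, the weighted
estimate `norm_V3_le_weighted` with `ρ = η²κ` ((38): `|tr(Z(Re U₀(∂p) − 1))| ≦ |Z|η²C₁B₃ε₁(Lʲη)⁻²`, «One factor η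
cancels η⁻¹ in the derivative (DA)(p)»: `η|(DA)(p)| ≦ |A|(∂p)`), and (33) `|V₄| ≦ (2/4!)(|A|(∂p))⁴`.
[cite: Balaban1985Variational, (39)-(40) p.284] -/
theorem ineq40_first {V₀ V₄ : ℂ} (h₁ : ‖Y₁‖ ≤ a₁) (h₂ : ‖Y₂‖ ≤ a₂) (h₃ : ‖Y₃‖ ≤ a₃) (h₄ : ‖Y₄‖ ≤ a₄)
    (hS : a₁ + a₂ + a₃ + a₄ ≤ S) (hηD : η * ‖D‖ ≤ S) (hη : 0 ≤ η) (hκ : 0 ≤ κ)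
    (hτ : τ (comm2 Y₁ Y₂ Y₃ Y₄ * D) = τ (D * comm2 Y₁ Y₂ Y₃ Y₄))
    (hRe1 : ∀ Z : 𝔸, ‖τ (Z * (ReU - 1))‖ ≤ ‖Z‖ * (η ^ 2 * κ))
    (hIm : ∀ Z : 𝔸, ‖τ (Z * ImU2)‖ ≤ ‖Z‖ * κ)
    (h29 : V₀ = V3 τ D Y₁ Y₂ Y₃ Y₄ ReU ImU2 η + V₄) (h33 : ‖V₄‖ ≤ 2 / 24 * S ^ 4) :
    ‖V₀ - (2 : ℂ)⁻¹ * Complex.I * τ (D * comm2 Y₁ Y₂ Y₃ Y₄)‖ ≤ S ^ 3 * η * κ + 2 / 24 * S ^ 4 := by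
  have hS0 : 0 ≤ S :=
    (add_nonneg (add_nonneg (add_nonneg ((norm_nonneg _).trans h₁) ((norm_nonneg _).trans h₂))
      ((norm_nonneg _).trans h₃)) ((norm_nonneg _).trans h₄)).trans hS
  have hsplit : V₀ - (2 : ℂ)⁻¹ * Complex.I * τ (D * comm2 Y₁ Y₂ Y₃ Y₄) =
      V3 τ D Y₁ Y₂ Y₃ Y₄ (ReU - 1) ImU2 η + V₄ := by
    rw [h29, V3_split39 hτ]; ring
  have hw := norm_V3_le_weighted (δ := ‖D‖) h₁ h₂ h₃ h₄ hS le_rfl hηD hη (by positivity) hκ hRe1 hIm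
  -- «One factor η cancels η⁻¹ in the derivative»: ½|D|S²·η²κ = ½η(η|D|)S²κ ≦ ½ηS³κ
  have hcancel : 1 / 2 * ‖D‖ * S ^ 2 * (η ^ 2 * κ) ≤ 1 / 2 * η * S ^ 3 * κ := by
    have : η * ‖D‖ * S ^ 2 ≤ S * S ^ 2 := by
      have := mul_le_mul_of_nonneg_right hηD (by positivity : (0:ℝ) ≤ S ^ 2); linarith
    have hηκ : 0 ≤ η * κ := mul_nonneg hη hκ
    have := mul_le_mul_of_nonneg_left this hηκ
    nlinarith
  rw [hsplit]
  calc ‖V3 τ D Y₁ Y₂ Y₃ Y₄ (ReU - 1) ImU2 η + V₄‖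
        ≤ ‖V3 τ D Y₁ Y₂ Y₃ Y₄ (ReU - 1) ImU2 η‖ + ‖V₄‖ := norm_add_le _ _
    _ ≤ (1 / 2 * ‖D‖ * S ^ 2 * (η ^ 2 * κ) + 1 / 2 * η * S ^ 3 * κ) + 2 / 24 * S ^ 4 := add_le_add hw h33
    _ ≤ (1 / 2 * η * S ^ 3 * κ + 1 / 2 * η * S ^ 3 * κ) + 2 / 24 * S ^ 4 := by linarith
    _ = S ^ 3 * η * κ + 2 / 24 * S ^ 4 := by ring

/-- **(40) as printed, end to end**: with `κ = K/t²`, `K = C₁B₃ε₁`, `t = Lʲη`, under (32) («Here we have used only the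
first bound (32) on the field A alone»: `|A| = a < ε₂(Lʲη)⁻¹`, `|A|(∂p) = S ≦ 4|A|`, `η ≦ Lʲη`):
`|V₀′(A, ∂p)| < 64ε₂³(C₁B₃ε₁ + ε₂)(Lʲη)⁻⁴` (first member `ineq40_first`, the further members `B11Smallness.ineq40`).
[cite: Balaban1985Variational, (40) p.284] -/
theorem ineq40_printed {V₀ V₄ : ℂ} {a t K ε₂ : ℝ} (h₁ : ‖Y₁‖ ≤ a₁) (h₂ : ‖Y₂‖ ≤ a₂) (h₃ : ‖Y₃‖ ≤ a₃)
    (h₄ : ‖Y₄‖ ≤ a₄) (hS : a₁ + a₂ + a₃ + a₄ ≤ S) (hηD : η * ‖D‖ ≤ S)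
    (hτ : τ (comm2 Y₁ Y₂ Y₃ Y₄ * D) = τ (D * comm2 Y₁ Y₂ Y₃ Y₄))
    (hRe1 : ∀ Z : 𝔸, ‖τ (Z * (ReU - 1))‖ ≤ ‖Z‖ * (η ^ 2 * (K / t ^ 2)))
    (hIm : ∀ Z : 𝔸, ‖τ (Z * ImU2)‖ ≤ ‖Z‖ * (K / t ^ 2))
    (h29 : V₀ = V3 τ D Y₁ Y₂ Y₃ Y₄ ReU ImU2 η + V₄) (h33 : ‖V₄‖ ≤ 2 / 24 * S ^ 4)
    (ht : 0 < t) (hη0 : 0 ≤ η) (hηt : η ≤ t) (ha0 : 0 ≤ a) (hSa : S ≤ 4 * a) (ha : a < ε₂ / t) (hK : 0 ≤ K) :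
    ‖V₀ - (2 : ℂ)⁻¹ * Complex.I * τ (D * comm2 Y₁ Y₂ Y₃ Y₄)‖ < 64 * ε₂ ^ 3 * (K + ε₂) / t ^ 4 := by
  have hκ : 0 ≤ K / t ^ 2 := by positivity
  have hS0 : 0 ≤ S :=
    (add_nonneg (add_nonneg (add_nonneg ((norm_nonneg _).trans h₁) ((norm_nonneg _).trans h₂))
      ((norm_nonneg _).trans h₃)) ((norm_nonneg _).trans h₄)).trans hS
  have hfirst := ineq40_first h₁ h₂ h₃ h₄ hS hηD hη0 hκ hτ hRe1 hIm h29 h33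
  obtain ⟨c1, c2, c3⟩ := B11Smallness.ineq40 a S η t K ε₂ ht hη0 hηt ha0 hS0 hSa ha hK
  have e : S ^ 3 * η * (K / t ^ 2) + 2 / 24 * S ^ 4 = S ^ 3 * η * K / t ^ 2 + 2 / 24 * S ^ 4 := by ring
  rw [e] at hfirst
  exact lt_of_le_of_lt ((hfirst.trans c1).trans c2) c3

end Ineq40

end Literature.MathematicalPhysics.QuantumFieldTheory.Balaban1983to89.B11Eq37NormBound
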